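import Mathlib
import HarnessLib
import Summits.Ventures.LatticeQCDFlow.Exactness.NCMCGeneralSpaceOccupancyChainHeatBath
import Summits.Ventures.LatticeQCDFlow.Exactness.NCMCGeneralSpaceSweepRestart

/-!
# End to end, the engine's actual level samplers: heat-bath-then-overrelaxation composites and the SU(N) Cabibbo–Marinari sweep keep the NCMC chain ergodic

HONEST FRAMING: exact (Metropolis-corrected) sampling algorithms for lattice gauge theory;
figures of merit are autocorrelation/cost numbers at stated couplings and volumes; no
continuum-physics claim.

Venture `LatticeQCDFlow` (cell pub-lqcd), topic `Exactness`; FANOUT row 13 (`eng-snf`, GEN-17).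
NEW WORK of the cell, not a published result; no definition is introduced; nothing is cited as a
fact.  ASSEMBLY of GEN-17's certificate (`NCMCGeneralSpaceOccupancyChainErgodic.lean`: Crooks pair +
level samplers that are invariant and minorised by non-zero measures ⇒ the expanded-ensemble chain
of `run_ncmc_chain` is ergodic, occupancy → `σ(c − ΔF)`, `dF_occ → ΔF` a.s.) with GEN-16's
`NCMCGeneralSpaceSweepRestart.measure_le_comp` (a minorisation survives any exact post-update) and
row 9's `CabibboMarinariLatticeErgodic.latSweep_minorised` / `latHit_invariant`
(`latSweep_invariant_withDensity`).  The engine's `n_sweeps_prior` / `n_sweeps_target` relaxation is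
`composite_sweep` = one heat-bath sweep followed by `n_or` over-relaxation sweeps (SU(2), U(1)), or
the Cabibbo–Marinari pseudo-heat-bath sweep (`lc_sweep`, SU(3)).

## Content

* §1 `comp_package` — if `K` is Markov, `ν`-invariant and minorised by a non-zero finite `m`, and
  `η` is any `ν`-invariant Markov kernel, then `η ∘ₖ K` is Markov, `ν`-invariant and minorised by the
  non-zero finite `η ∘ₘ m`.  **`CrooksPair.ncmc_comp`** — the certificate's three conclusions for level
  samplers `η₀ ∘ₖ K₀`, `η₁ ∘ₖ K₁`.
* §2 **`CrooksPair.ncmc_wilsonHeatBathComp`** — torus Wilson theory, compact second-countable `G`,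
  continuous `ρ`; prior `wilsonWeight ρ β₀`, target `wilsonWeight ρ β₁`; level samplers = heat-bath
  link sweep at `β_k` followed by ANY `wilsonWeight ρ β_k`-invariant Markov kernel `η_k` (the `n_or`
  over-relaxation sweeps): ergodic, occupancy → `σ(c − ΔF)`, `dF_occ → ΔF` a.s.
* §3 `cmSweep_package`, **`CrooksPair.ncmc_wilsonCMSweep`** — gauge group `SU(N)`
  (`Matrix.specialUnitaryGroup n ℂ`), level samplers = the Cabibbo–Marinari sweeps at `β₀` / `β₁`
  over every link with the lexicographic (or reversed) list of coordinate pairs: the same three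
  conclusions — END TO END for the SU(3) engine's NCMC mode.

NOT CLAIMED: rates or error bars; HMC as a level sampler; anything numerical.
-/

namespace Summit.Ventures.LatticeQCDFlow.Exactness.GeneralNCMC

open MeasureTheory ProbabilityTheory Set Filter Finset
open scoped ENNReal Topology

/-! ## §1 Composite level samplers: an exact update after a minorised one -/

section Comp

variable {Ω : Type*} [MeasurableSpace Ω]

/-- **A package passes to a composite.**  `K` Markov, `ν`-invariant, minorised by a non-zero finite
`m`; `η` Markov and `ν`-invariant ⇒ `η ∘ₖ K` is Markov, `ν`-invariant and minorised by the non-zero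
finite measure `η ∘ₘ m`. -/
theorem comp_package (K η : Kernel Ω Ω) [IsMarkovKernel K] [IsMarkovKernel η] {ν : Measure Ω}
    (hK : Kernel.Invariant K ν) (hη : Kernel.Invariant η ν) {m : Measure Ω} [IsFiniteMeasure m]
    (hm0 : m univ ≠ 0) (hmin : ∀ z, m ≤ K z) :
    ∃ (_ : IsMarkovKernel (η ∘ₖ K)) (mm : Measure Ω) (_ : IsFiniteMeasure mm),
      mm univ ≠ 0 ∧ Kernel.Invariant (η ∘ₖ K) ν ∧ ∀ z, mm ≤ (η ∘ₖ K) z := by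
  have hfin : IsFiniteMeasure (m.bind η) :=
    ⟨by rw [bind_apply_univ_of_markov η m]; exact measure_lt_top _ _⟩
  exact ⟨inferInstance, m.bind η, hfin, by rwa [bind_apply_univ_of_markov η m], hη.comp hK,
    measure_le_comp K η hmin⟩

variable {E : Type*} [MeasurableSpace E]
variable {ν₀ ν₁ : Measure Ω} [IsFiniteMeasure ν₀] [IsFiniteMeasure ν₁] {κF κR : Kernel Ω E}
  [IsMarkovKernel κF] [IsMarkovKernel κR] {s e : E → Ω} {W : E → ℝ}

/-- **Composite level samplers keep the NCMC chain ergodic.**  Crooks pair between finite non-zero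
level weights; `K₀`, `K₁` Markov, invariant, minorised by non-zero finite measures; `η₀`, `η₁` ANY
invariant Markov kernels; level samplers `η₀ ∘ₖ K₀`, `η₁ ∘ₖ K₁`; ANY `c`: the expanded-ensemble
chain started in `π_c` is ergodic, the occupancy fraction converges to `σ(c − ΔF)` and `dF_occ,n`
to `ΔF` almost surely. -/
theorem CrooksPair.ncmc_comp (h : CrooksPair ν₀ ν₁ κF κR s e W) (h0 : ν₀ univ ≠ 0)
    (h1 : ν₁ univ ≠ 0) (K₀ η₀ K₁ η₁ : Kernel Ω Ω) [IsMarkovKernel K₀] [IsMarkovKernel η₀]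
    [IsMarkovKernel K₁] [IsMarkovKernel η₁] (hK₀ : Kernel.Invariant K₀ ν₀)
    (hη₀ : Kernel.Invariant η₀ ν₀) (hK₁ : Kernel.Invariant K₁ ν₁) (hη₁ : Kernel.Invariant η₁ ν₁)
    {m₀ m₁ : Measure Ω} [IsFiniteMeasure m₀] [IsFiniteMeasure m₁] (hm₀ : m₀ univ ≠ 0)
    (hm₁ : m₁ univ ≠ 0) (hmin₀ : ∀ z, m₀ ≤ K₀ z) (hmin₁ : ∀ z, m₁ ≤ K₁ z) (c : ℝ) {ΔF : ℝ}
    (hΔF : Real.exp (-ΔF) = ((ν₀ univ)⁻¹ * ν₁ univ).toReal) :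
    ∃ (_ : IsMarkovKernel (switchKernel κF κR c W s e))
      (_ : IsMarkovKernel (levelKernel (η₀ ∘ₖ K₀) (η₁ ∘ₖ K₁)))
      (_ : IsProbabilityMeasure ((jointWeight c ν₀ ν₁ univ)⁻¹ • jointWeight c ν₀ ν₁)),
      Ergodic (fun (z : ℕ → Bool × Ω) (k : ℕ) => z (k + 1))
        (Kernel.trajMeasure (X := fun _ : ℕ => Bool × Ω)
          ((jointWeight c ν₀ ν₁ univ)⁻¹ • jointWeight c ν₀ ν₁)
          (fun n : ℕ => (switchKernel κF κR c W s e ∘ₖ levelKernel (η₀ ∘ₖ K₀) (η₁ ∘ₖ K₁)).comap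
            (fun hh : (j : ↥(Finset.Iic n)) → Bool × Ω => hh ⟨n, Finset.mem_Iic.2 le_rfl⟩)
            (measurable_pi_apply _))) ∧
      ∀ᵐ z ∂(Kernel.trajMeasure (X := fun _ : ℕ => Bool × Ω)
          ((jointWeight c ν₀ ν₁ univ)⁻¹ • jointWeight c ν₀ ν₁)
          (fun n : ℕ => (switchKernel κF κR c W s e ∘ₖ levelKernel (η₀ ∘ₖ K₀) (η₁ ∘ₖ K₁)).comap
            (fun hh : (j : ↥(Finset.Iic n)) → Bool × Ω => hh ⟨n, Finset.mem_Iic.2 le_rfl⟩)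
            (measurable_pi_apply _))),
        Tendsto (fun n : ℕ =>
            (∑ i ∈ range n, (targetLevel Ω).indicator (1 : Bool × Ω → ℝ) (z i)) / n)
          atTop (𝓝 (Real.sigmoid (c - ΔF))) ∧
        Tendsto (fun n : ℕ => c - Real.log
            ((∑ i ∈ range n, (targetLevel Ω).indicator (1 : Bool × Ω → ℝ) (z i)) / n /
              (1 - (∑ i ∈ range n, (targetLevel Ω).indicator (1 : Bool × Ω → ℝ) (z i)) / n)))
          atTop (𝓝 ΔF) := by
  obtain ⟨hMk₀, mm₀, hmfin₀, hmm₀, hT₀, hmin₀'⟩ := comp_package K₀ η₀ hK₀ hη₀ hm₀ hmin₀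
  obtain ⟨hMk₁, mm₁, hmfin₁, hmm₁, hT₁, hmin₁'⟩ := comp_package K₁ η₁ hK₁ hη₁ hm₁ hmin₁
  haveI := hmfin₀
  haveI := hmfin₁
  refine ⟨isMarkovKernel_switchKernel (κF := κF) (κR := κR) (c := c)
      h.measurable_W h.measurable_s h.measurable_e,
    isMarkovKernel_levelKernel _ _, isProbabilityMeasure_jointLaw c _ _ h0,
    h.ergodic_ncmcChain h0 h1 hT₀ hT₁ hmm₀ hmm₁ hmin₀' hmin₁' c, ?_⟩
  exact (h.tendsto_occupancy_ae_ncmcChain h0 h1 hT₀ hT₁ hmm₀ hmm₁ hmin₀' hmin₁' c hΔF).and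
    (h.tendsto_dFocc_ae_ncmcChain h0 h1 hT₀ hT₁ hmm₀ hmm₁ hmin₀' hmin₁' c hΔF)

end Comp

/-! ## §2 Torus Wilson theory: heat bath then any exact update (`1HB + n_or OR`) -/

section WilsonComp

open Literature.MathematicalPhysics.QuantumFieldTheory

variable {d L N : ℕ} {G : Type*} [Group G] [TopologicalSpace G] [IsTopologicalGroup G]
  (ρ : G →* Matrix (Fin N) (Fin N) ℂ) [CompactSpace G] [MeasurableSpace G] [BorelSpace G]
  [SecondCountableTopology G]

/-- **THE `composite_sweep` INSTANCE.**  Torus Wilson theory, compact second-countable `G`,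
continuous `ρ`, `L ≠ 0`; prior `wilsonWeight ρ β₀`, target `wilsonWeight ρ β₁`; level samplers =
the heat-bath link sweep at `β_k` over an edge list visiting every edge FOLLOWED BY any Markov kernel
`η_k` leaving `wilsonWeight ρ β_k` invariant (e.g. `n_or` over-relaxation sweeps); ANY Crooks pair
between the two weights, ANY `c`: the expanded-ensemble chain started in `π_c` is ergodic, the
occupancy fraction converges to `σ(c − ΔF)` and `dF_occ,n` to `ΔF` almost surely. -/
theorem CrooksPair.ncmc_wilsonHeatBathComp [NeZero L] (hρ : Continuous ρ) (β₀ β₁ : ℝ)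
    {l₀ l₁ : List (Edge d L)} (hl₀ : ∀ ed, ed ∈ l₀) (hl₁ : ∀ ed, ed ∈ l₁)
    (η₀ η₁ : Kernel (GaugeConfig d L G) (GaugeConfig d L G)) [IsMarkovKernel η₀] [IsMarkovKernel η₁]
    (hη₀ : Kernel.Invariant η₀ (wilsonWeight (d := d) (L := L) ρ β₀))
    (hη₁ : Kernel.Invariant η₁ (wilsonWeight (d := d) (L := L) ρ β₁))
    {E : Type*} [MeasurableSpace E] {κF κR : Kernel (GaugeConfig d L G) E} [IsMarkovKernel κF]
    [IsMarkovKernel κR] {s e : E → GaugeConfig d L G} {W : E → ℝ}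
    (h : CrooksPair (wilsonWeight (d := d) (L := L) ρ β₀) (wilsonWeight (d := d) (L := L) ρ β₁)
      κF κR s e W) (c : ℝ) {ΔF : ℝ}
    (hΔF : Real.exp (-ΔF) = (((wilsonWeight (d := d) (L := L) ρ β₀) univ)⁻¹ *
      (wilsonWeight (d := d) (L := L) ρ β₁) univ).toReal) :
    ∃ (_ : IsMarkovKernel (switchKernel κF κR c W s e))
      (_ : IsMarkovKernel (levelKernel
        (η₀ ∘ₖ cycle (l₀.map (siteHeatBath (fun _ : Edge d L => haarProbability G)
          (gibbsDensity fun U : GaugeConfig d L G => β₀ * wilsonAction ρ U))))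
        (η₁ ∘ₖ cycle (l₁.map (siteHeatBath (fun _ : Edge d L => haarProbability G)
          (gibbsDensity fun U : GaugeConfig d L G => β₁ * wilsonAction ρ U))))))
      (_ : IsProbabilityMeasure ((jointWeight c (wilsonWeight (d := d) (L := L) ρ β₀)
        (wilsonWeight (d := d) (L := L) ρ β₁) univ)⁻¹ •
        jointWeight c (wilsonWeight (d := d) (L := L) ρ β₀) (wilsonWeight (d := d) (L := L) ρ β₁))),
      Ergodic (fun (z : ℕ → Bool × GaugeConfig d L G) (k : ℕ) => z (k + 1))
        (Kernel.trajMeasure (X := fun _ : ℕ => Bool × GaugeConfig d L G)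
          ((jointWeight c (wilsonWeight (d := d) (L := L) ρ β₀)
            (wilsonWeight (d := d) (L := L) ρ β₁) univ)⁻¹ •
            jointWeight c (wilsonWeight (d := d) (L := L) ρ β₀) (wilsonWeight (d := d) (L := L) ρ β₁))
          (fun n : ℕ => (switchKernel κF κR c W s e ∘ₖ levelKernel
            (η₀ ∘ₖ cycle (l₀.map (siteHeatBath (fun _ : Edge d L => haarProbability G)
              (gibbsDensity fun U : GaugeConfig d L G => β₀ * wilsonAction ρ U))))
            (η₁ ∘ₖ cycle (l₁.map (siteHeatBath (fun _ : Edge d L => haarProbability G)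
              (gibbsDensity fun U : GaugeConfig d L G => β₁ * wilsonAction ρ U))))).comap
            (fun hh : (j : ↥(Finset.Iic n)) → Bool × GaugeConfig d L G =>
              hh ⟨n, Finset.mem_Iic.2 le_rfl⟩) (measurable_pi_apply _))) ∧
      ∀ᵐ z ∂(Kernel.trajMeasure (X := fun _ : ℕ => Bool × GaugeConfig d L G)
          ((jointWeight c (wilsonWeight (d := d) (L := L) ρ β₀)
            (wilsonWeight (d := d) (L := L) ρ β₁) univ)⁻¹ •
            jointWeight c (wilsonWeight (d := d) (L := L) ρ β₀) (wilsonWeight (d := d) (L := L) ρ β₁))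
          (fun n : ℕ => (switchKernel κF κR c W s e ∘ₖ levelKernel
            (η₀ ∘ₖ cycle (l₀.map (siteHeatBath (fun _ : Edge d L => haarProbability G)
              (gibbsDensity fun U : GaugeConfig d L G => β₀ * wilsonAction ρ U))))
            (η₁ ∘ₖ cycle (l₁.map (siteHeatBath (fun _ : Edge d L => haarProbability G)
              (gibbsDensity fun U : GaugeConfig d L G => β₁ * wilsonAction ρ U))))).comap
            (fun hh : (j : ↥(Finset.Iic n)) → Bool × GaugeConfig d L G =>
              hh ⟨n, Finset.mem_Iic.2 le_rfl⟩) (measurable_pi_apply _))),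
        Tendsto (fun n : ℕ => (∑ i ∈ range n,
            (targetLevel (GaugeConfig d L G)).indicator (1 : Bool × GaugeConfig d L G → ℝ) (z i)) / n)
          atTop (𝓝 (Real.sigmoid (c - ΔF))) ∧
        Tendsto (fun n : ℕ => c - Real.log
            ((∑ i ∈ range n, (targetLevel (GaugeConfig d L G)).indicator
                (1 : Bool × GaugeConfig d L G → ℝ) (z i)) / n /
              (1 - (∑ i ∈ range n, (targetLevel (GaugeConfig d L G)).indicator
                (1 : Bool × GaugeConfig d L G → ℝ) (z i)) / n)))
          atTop (𝓝 ΔF) := by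
  obtain ⟨hMk₀, hfin₀, m₀, hmfin₀, h0, hm₀, hK₀, hmin₀⟩ := wilson_heatBathSweep_package ρ hρ β₀ hl₀
  obtain ⟨hMk₁, hfin₁, m₁, hmfin₁, h1, hm₁, hK₁, hmin₁⟩ := wilson_heatBathSweep_package ρ hρ β₁ hl₁
  haveI := hMk₀
  haveI := hMk₁
  haveI := hfin₀
  haveI := hfin₁
  haveI := hmfin₀
  haveI := hmfin₁
  exact h.ncmc_comp h0 h1 _ η₀ _ η₁ hK₀ hη₀ hK₁ hη₁ hm₀ hm₁ hmin₀ hmin₁ c hΔF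

end WilsonComp

/-! ## §3 Torus Wilson theory with gauge group `SU(N)`: the Cabibbo–Marinari sweep -/

section CM

open Literature.MathematicalPhysics.QuantumFieldTheory

variable {n : Type*} [Fintype n] [DecidableEq n] [Nonempty n] [LinearOrder n]
variable {m : Type*} [Fintype m] [DecidableEq m]
variable {d L N : ℕ} (ρ : Matrix.specialUnitaryGroup n ℂ →* Matrix (Fin N) (Fin N) ℂ)

/-- **The Cabibbo–Marinari package of a torus Wilson weight** (gauge group `SU(N)`): for
`wilsonWeight ρ β`, `ρ` continuous, frames listing the coordinate pairs lexicographically (or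
reversed) and a link list visiting every edge, the Cabibbo–Marinari sweep is Markov, leaves the
weight invariant and dominates one non-zero finite measure from every configuration; the weight is
finite and non-zero. -/
theorem wilson_cmSweep_package [NeZero L] (hρ : Continuous ρ) (β : ℝ) (frames : List (n ≃ Fin 2 ⊕ m))
    (hlex : frames.map pairOf = lexPairs (Finset.univ.sort (· ≤ ·) : List n) ∨
      frames.map pairOf = (lexPairs (Finset.univ.sort (· ≤ ·) : List n)).reverse)
    {links : List (Edge d L)} (hl : ∀ ed, ed ∈ links) :
    ∃ (_ : IsMarkovKernel (latSweep (gibbsDensity fun U : GaugeConfig d L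
        (Matrix.specialUnitaryGroup n ℂ) => β * wilsonAction ρ U) frames links))
      (_ : IsFiniteMeasure (wilsonWeight (d := d) (L := L) ρ β))
      (mm : Measure (GaugeConfig d L (Matrix.specialUnitaryGroup n ℂ))) (_ : IsFiniteMeasure mm),
      wilsonWeight (d := d) (L := L) ρ β univ ≠ 0 ∧ mm univ ≠ 0 ∧
      Kernel.Invariant (latSweep (gibbsDensity fun U : GaugeConfig d L
        (Matrix.specialUnitaryGroup n ℂ) => β * wilsonAction ρ U) frames links)
        (wilsonWeight (d := d) (L := L) ρ β) ∧
      ∀ z, mm ≤ latSweep (gibbsDensity fun U : GaugeConfig d L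
        (Matrix.specialUnitaryGroup n ℂ) => β * wilsonAction ρ U) frames links z := by
  have hS : Continuous fun U : GaugeConfig d L (Matrix.specialUnitaryGroup n ℂ) =>
      β * wilsonAction ρ U := continuous_smul_wilsonAction ρ hρ β
  haveI : Nonempty (GaugeConfig d L (Matrix.specialUnitaryGroup n ℂ)) := ⟨fun _ => 1⟩
  obtain ⟨ωa, -, hmin⟩ := isCompact_univ.exists_isMinOn Set.univ_nonempty hS.continuousOn
  obtain ⟨ωb, -, hmax⟩ := isCompact_univ.exists_isMaxOn Set.univ_nonempty hS.continuousOn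
  have hωa : ∀ U, β * wilsonAction ρ ωa ≤ β * wilsonAction ρ U :=
    fun U => (isMinOn_iff.1 hmin) U (Set.mem_univ U)
  have hωb : ∀ U, β * wilsonAction ρ U ≤ β * wilsonAction ρ ωb :=
    fun U => (isMaxOn_iff.1 hmax) U (Set.mem_univ U)
  have hm0 : ENNReal.ofReal (Real.exp (-(β * wilsonAction ρ ωb))) ≠ 0 := by
    rw [ne_eq, ENNReal.ofReal_eq_zero, not_le]; exact Real.exp_pos _
  have hp := measurable_gibbsDensity hS
  have hmp := fun ω => (gibbsDensity_bounds hωa hωb ω).1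
  have hpM := fun ω => (gibbsDensity_bounds hωa hωb ω).2
  have hMk := isMarkovKernel_latSweep hp hm0 ENNReal.ofReal_ne_top hmp hpM frames links
  have hfin : IsFiniteMeasure (wilsonWeight (d := d) (L := L) ρ β) := by
    rw [wilsonWeight_eq_pi_withDensity]
    exact isFiniteMeasure_pi_withDensity
      (μ := fun _ : Edge d L => haarProbability (Matrix.specialUnitaryGroup n ℂ))
      ENNReal.ofReal_ne_top hpM
  have h0 : wilsonWeight (d := d) (L := L) ρ β univ ≠ 0 := by
    rw [wilsonWeight_eq_pi_withDensity]
    exact pi_withDensity_univ_ne_zero hm0 hmp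
  have hK : Kernel.Invariant (latSweep (gibbsDensity fun U : GaugeConfig d L
      (Matrix.specialUnitaryGroup n ℂ) => β * wilsonAction ρ U) frames links)
      (wilsonWeight (d := d) (L := L) ρ β) := by
    rw [wilsonWeight_eq_pi_withDensity]
    exact latSweep_invariant_withDensity hp hm0 ENNReal.ofReal_ne_top hmp hpM frames links
  obtain ⟨ε, hε, hεmin⟩ := latSweep_minorised hp hm0 ENNReal.ofReal_ne_top hmp hpM frames hlex hl
  have hε1 : ε ≤ 1 := by
    have h1 := Measure.le_iff'.1 (hεmin 1) Set.univ
    rwa [Measure.smul_apply, smul_eq_mul, measure_univ, measure_univ, mul_one] at h1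
  have hmfin : IsFiniteMeasure (ε • Measure.pi (linkHaar (Edge d L) n)) :=
    Measure.smul_finite _ (ne_top_of_le_ne_top ENNReal.one_ne_top hε1)
  have hmu : (ε • Measure.pi (linkHaar (Edge d L) n)) univ ≠ 0 := by
    rw [Measure.smul_apply, smul_eq_mul, measure_univ, mul_one]
    exact hε
  exact ⟨hMk, hfin, _, hmfin, h0, hmu, hK, hεmin⟩

/-- **THE SU(N) `lc_sweep` INSTANCE.**  Torus Wilson theory with gauge group `SU(N)`, continuous
`ρ`, `L ≠ 0`; prior `wilsonWeight ρ β₀`, target `wilsonWeight ρ β₁`; level samplers = the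
Cabibbo–Marinari sweeps at `β₀` / `β₁` (every link, the coordinate pairs lexicographically or
reversed); ANY Crooks pair between the two weights, ANY `c`: the expanded-ensemble chain started in
`π_c` is ergodic, the occupancy fraction converges to `σ(c − ΔF)` and `dF_occ,n` to `ΔF` almost
surely. -/
theorem CrooksPair.ncmc_wilsonCMSweep [NeZero L] (hρ : Continuous ρ) (β₀ β₁ : ℝ)
    (frames₀ frames₁ : List (n ≃ Fin 2 ⊕ m))
    (hlex₀ : frames₀.map pairOf = lexPairs (Finset.univ.sort (· ≤ ·) : List n) ∨
      frames₀.map pairOf = (lexPairs (Finset.univ.sort (· ≤ ·) : List n)).reverse)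
    (hlex₁ : frames₁.map pairOf = lexPairs (Finset.univ.sort (· ≤ ·) : List n) ∨
      frames₁.map pairOf = (lexPairs (Finset.univ.sort (· ≤ ·) : List n)).reverse)
    {links₀ links₁ : List (Edge d L)} (hl₀ : ∀ ed, ed ∈ links₀) (hl₁ : ∀ ed, ed ∈ links₁)
    {E : Type*} [MeasurableSpace E]
    {κF κR : Kernel (GaugeConfig d L (Matrix.specialUnitaryGroup n ℂ)) E} [IsMarkovKernel κF]
    [IsMarkovKernel κR] {s e : E → GaugeConfig d L (Matrix.specialUnitaryGroup n ℂ)} {W : E → ℝ}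
    (h : CrooksPair (wilsonWeight (d := d) (L := L) ρ β₀) (wilsonWeight (d := d) (L := L) ρ β₁)
      κF κR s e W) (c : ℝ) {ΔF : ℝ}
    (hΔF : Real.exp (-ΔF) = (((wilsonWeight (d := d) (L := L) ρ β₀) univ)⁻¹ *
      (wilsonWeight (d := d) (L := L) ρ β₁) univ).toReal) :
    ∃ (_ : IsMarkovKernel (switchKernel κF κR c W s e))
      (_ : IsMarkovKernel (levelKernel
        (latSweep (gibbsDensity fun U : GaugeConfig d L (Matrix.specialUnitaryGroup n ℂ) =>
          β₀ * wilsonAction ρ U) frames₀ links₀)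
        (latSweep (gibbsDensity fun U : GaugeConfig d L (Matrix.specialUnitaryGroup n ℂ) =>
          β₁ * wilsonAction ρ U) frames₁ links₁)))
      (_ : IsProbabilityMeasure ((jointWeight c (wilsonWeight (d := d) (L := L) ρ β₀)
        (wilsonWeight (d := d) (L := L) ρ β₁) univ)⁻¹ •
        jointWeight c (wilsonWeight (d := d) (L := L) ρ β₀) (wilsonWeight (d := d) (L := L) ρ β₁))),
      Ergodic (fun (z : ℕ → Bool × GaugeConfig d L (Matrix.specialUnitaryGroup n ℂ)) (k : ℕ) =>
          z (k + 1))
        (Kernel.trajMeasure (X := fun _ : ℕ => Bool × GaugeConfig d L (Matrix.specialUnitaryGroup n ℂ))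
          ((jointWeight c (wilsonWeight (d := d) (L := L) ρ β₀)
            (wilsonWeight (d := d) (L := L) ρ β₁) univ)⁻¹ •
            jointWeight c (wilsonWeight (d := d) (L := L) ρ β₀) (wilsonWeight (d := d) (L := L) ρ β₁))
          (fun k : ℕ => (switchKernel κF κR c W s e ∘ₖ levelKernel
            (latSweep (gibbsDensity fun U : GaugeConfig d L (Matrix.specialUnitaryGroup n ℂ) =>
              β₀ * wilsonAction ρ U) frames₀ links₀)
            (latSweep (gibbsDensity fun U : GaugeConfig d L (Matrix.specialUnitaryGroup n ℂ) =>
              β₁ * wilsonAction ρ U) frames₁ links₁)).comap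
            (fun hh : (j : ↥(Finset.Iic k)) → Bool × GaugeConfig d L (Matrix.specialUnitaryGroup n ℂ) =>
              hh ⟨k, Finset.mem_Iic.2 le_rfl⟩) (measurable_pi_apply _))) ∧
      ∀ᵐ z ∂(Kernel.trajMeasure
          (X := fun _ : ℕ => Bool × GaugeConfig d L (Matrix.specialUnitaryGroup n ℂ))
          ((jointWeight c (wilsonWeight (d := d) (L := L) ρ β₀)
            (wilsonWeight (d := d) (L := L) ρ β₁) univ)⁻¹ •
            jointWeight c (wilsonWeight (d := d) (L := L) ρ β₀) (wilsonWeight (d := d) (L := L) ρ β₁))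
          (fun k : ℕ => (switchKernel κF κR c W s e ∘ₖ levelKernel
            (latSweep (gibbsDensity fun U : GaugeConfig d L (Matrix.specialUnitaryGroup n ℂ) =>
              β₀ * wilsonAction ρ U) frames₀ links₀)
            (latSweep (gibbsDensity fun U : GaugeConfig d L (Matrix.specialUnitaryGroup n ℂ) =>
              β₁ * wilsonAction ρ U) frames₁ links₁)).comap
            (fun hh : (j : ↥(Finset.Iic k)) → Bool × GaugeConfig d L (Matrix.specialUnitaryGroup n ℂ) =>
              hh ⟨k, Finset.mem_Iic.2 le_rfl⟩) (measurable_pi_apply _))),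
        Tendsto (fun k : ℕ => (∑ i ∈ range k,
            (targetLevel (GaugeConfig d L (Matrix.specialUnitaryGroup n ℂ))).indicator
              (1 : Bool × GaugeConfig d L (Matrix.specialUnitaryGroup n ℂ) → ℝ) (z i)) / k)
          atTop (𝓝 (Real.sigmoid (c - ΔF))) ∧
        Tendsto (fun k : ℕ => c - Real.log
            ((∑ i ∈ range k, (targetLevel (GaugeConfig d L (Matrix.specialUnitaryGroup n ℂ))).indicator
                (1 : Bool × GaugeConfig d L (Matrix.specialUnitaryGroup n ℂ) → ℝ) (z i)) / k /
              (1 - (∑ i ∈ range k,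
                (targetLevel (GaugeConfig d L (Matrix.specialUnitaryGroup n ℂ))).indicator
                  (1 : Bool × GaugeConfig d L (Matrix.specialUnitaryGroup n ℂ) → ℝ) (z i)) / k)))
          atTop (𝓝 ΔF) := by
  obtain ⟨hMk₀, hfin₀, mm₀, hmfin₀, h0, hm₀, hK₀, hmin₀⟩ :=
    wilson_cmSweep_package ρ hρ β₀ frames₀ hlex₀ hl₀
  obtain ⟨hMk₁, hfin₁, mm₁, hmfin₁, h1, hm₁, hK₁, hmin₁⟩ :=
    wilson_cmSweep_package ρ hρ β₁ frames₁ hlex₁ hl₁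
  haveI := hMk₀
  haveI := hMk₁
  haveI := hfin₀
  haveI := hfin₁
  haveI := hmfin₀
  haveI := hmfin₁
  refine ⟨isMarkovKernel_switchKernel (κF := κF) (κR := κR) (c := c)
      h.measurable_W h.measurable_s h.measurable_e,
    isMarkovKernel_levelKernel _ _, isProbabilityMeasure_jointLaw c _ _ h0,
    h.ergodic_ncmcChain h0 h1 hK₀ hK₁ hm₀ hm₁ hmin₀ hmin₁ c, ?_⟩
  exact (h.tendsto_occupancy_ae_ncmcChain h0 h1 hK₀ hK₁ hm₀ hm₁ hmin₀ hmin₁ c hΔF).and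
    (h.tendsto_dFocc_ae_ncmcChain h0 h1 hK₀ hK₁ hm₀ hm₁ hmin₀ hmin₁ c hΔF)

end CM

end Summit.Ventures.LatticeQCDFlow.Exactness.GeneralNCMC
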